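import Mathlib
import Summits.ValiantsHypothesis.ValiantsHypothesis.Theorems.KPlusLogSqLawTridiagonalRealStaticFaceRule

/-!
# A first MAGNITUDE-BASED sub-Descartes row in the α register: the two-speed pattern (1,−1,−3,3) never saturates

Worked instance of `faceRule_of_sharp` (`…TridiagonalRealStaticFaceRule`, p656498): a static symmetric tridiagonal monomial design of
size 5 with nonzero diagonal coefficients and links whose edge SLOPES `L_j = 2f_j − d_j − d_{j+1}` are `(1, −1, −3, 3)` has matching
slope-sums `−3, −2, …, 4` (the 8 matchings ↦ 8 consecutive integers, so `D_5` is an octonomial up to a monomial factor and Descartes allows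
7 positive roots, with PERFECT sign alternation for every choice of magnitudes).  ENS forbids the seventh root: the face `(∅; 0, 2)`
(opposite-sign slopes) would need `W_∅ · W_{{0,2}} ≥ W_{{0}} · W_{{2}}`, i.e. `144 · 720 ≥ 144 · 5040` — false.  Hence
`card_posRoots_le_six_twoSpeed`: **Z(D_5) ≤ 6** on the whole pattern (any magnitudes, any exponents with these slopes) — a sector row
below the Descartes count obtained from MAGNITUDES (the gap products), not from exponent coincidences.

HONEST FRAMING: a narrow sector row at m = 5 (B5 = 7 is attained by other slopes and stays); α NO MOVER; nothing on
WeakLifting/TropicalB windows, Conjecture B, the doors, MatrixDescartes (18050) or VP ≠ VNP.  Seat: prover val-sym-lift-p2 g17,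
`--supports stmt-ValiantsHypothesis-19561`.
-/

set_option linter.dupNamespace false
set_option autoImplicit false

namespace Summit.ValiantsHypothesis.ValiantsHypothesis.Theorems.KPlusLogSqLaw

namespace EdgeNormalForm

open Polynomial Finset
open Summit.ValiantsHypothesis.ValiantsHypothesis.Theorems.KPlusLogSqLaw.StaticTridiagonalRealPotential (pathDet)

/-- The matchings of the path with 4 edges `0,1,2,3`. [bookkeeping] -/
theorem matchings_four : ((range 4).powerset.filter fun N : Finset ℕ => ∀ j ∈ N, j + 1 ∉ N) =
    ({∅, {0}, {1}, {2}, {3}, {0, 2}, {0, 3}, {1, 3}} : Finset (Finset ℕ)) := by decide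

/-- Products over a sub-finset of the subtype `↥s` of a function of the underlying set are products over its image. [bookkeeping] -/
theorem prod_subtype_val {s : Finset (Finset ℕ)} (T : Finset ↥s) (g : Finset ℕ → ℝ) :
    ∏ M ∈ T, g (M : Finset ℕ) = ∏ N ∈ T.map (Function.Embedding.subtype _), g N := by
  rw [Finset.prod_map]
  rfl

/-- **TWO-SPEED PATTERN (1,−1,−3,3): Z(D_5) ≤ 6** — one below the Descartes count 7, for every choice of nonzero diagonal
coefficients, nonzero links and exponents with these edge slopes. [this work] -/
theorem card_posRoots_le_six_twoSpeed (a : ℕ → ℝ) (d : ℕ → ℕ) (b : ℕ → ℝ) (f : ℕ → ℕ)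
    (ha : ∀ j, a j ≠ 0) (hb : ∀ j, b j ≠ 0)
    (h0 : 2 * f 0 = d 0 + d 1 + 1) (h1 : 2 * f 1 + 1 = d 1 + d 2) (h2 : 2 * f 2 + 3 = d 2 + d 3)
    (h3 : 2 * f 3 = d 3 + d 4 + 3) :
    ((pathDet a d b f 5).roots.toFinset.filter fun x => 0 < x).card ≤ 6 := by
  classical
  by_contra hcon
  rw [not_le] at hcon
  -- slopes
  set L : ℕ → ℝ := fun j => 2 * (f j : ℝ) - d j - d (j + 1) with hL
  have hL0 : L 0 = 1 := by
    have := congrArg (fun n : ℕ => (n : ℝ)) h0; push_cast at this; simp only [hL]; linarith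
  have hL1 : L 1 = -1 := by
    have := congrArg (fun n : ℕ => (n : ℝ)) h1; push_cast at this; simp only [hL]; linarith
  have hL2 : L 2 = -3 := by
    have := congrArg (fun n : ℕ => (n : ℝ)) h2; push_cast at this; simp only [hL]; linarith
  have hL3 : L 3 = 3 := by
    have := congrArg (fun n : ℕ => (n : ℝ)) h3; push_cast at this; simp only [hL]; linarith
  set τ : Finset ℕ → ℝ := fun N => ∑ j ∈ N, L j with hτ
  have t0 : τ ∅ = 0 := by simp [hτ]
  have t1 : τ {0} = 1 := by simp [hτ, hL0]
  have t2 : τ {1} = -1 := by simp [hτ, hL1]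
  have t3 : τ {2} = -3 := by simp [hτ, hL2]
  have t4 : τ {3} = 3 := by simp [hτ, hL3]
  have t5 : τ {0, 2} = -2 := by simp [hτ, hL0, hL2]; norm_num
  have t6 : τ {0, 3} = 4 := by simp [hτ, hL0, hL3]; norm_num
  have t7 : τ {1, 3} = 2 := by simp [hτ, hL1, hL3]; norm_num
  -- the data of `faceRule_of_sharp` at `m = 5`
  set S : Finset (Finset ℕ) := (range 4).powerset with hS
  set σ : ↥S → ℝ := fun M => ∑ j ∈ (M : Finset ℕ), (2 * (f j : ℝ) - d j - d (j + 1)) with hσ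
  have hστ : ∀ M : ↥S, σ M = τ (M : Finset ℕ) := fun M => rfl
  set Act : Finset ↥S := Finset.univ.filter fun (M : ↥S) => ∀ j ∈ (M : Finset ℕ), j + 1 ∉ (M : Finset ℕ) with hAct
  -- image of `Act` in `Finset (Finset ℕ)`
  have hActmap : Act.map (Function.Embedding.subtype _) = ({∅, {0}, {1}, {2}, {3}, {0, 2}, {0, 3}, {1, 3}} : Finset (Finset ℕ)) := by
    rw [← matchings_four]
    ext N
    rw [Finset.mem_map, Finset.mem_filter, Finset.mem_powerset]
    constructor
    · rintro ⟨M, hM, rfl⟩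
      exact ⟨Finset.mem_powerset.mp (by rw [← hS]; exact M.2), (Finset.mem_filter.mp hM).2⟩
    · rintro ⟨hN, hP⟩
      exact ⟨⟨N, by rw [hS]; exact Finset.mem_powerset.mpr hN⟩, Finset.mem_filter.mpr ⟨Finset.mem_univ _, hP⟩, rfl⟩
  have hmemAct : ∀ M : ↥S, M ∈ Act ↔ (M : Finset ℕ) ∈ ({∅, {0}, {1}, {2}, {3}, {0, 2}, {0, 3}, {1, 3}} : Finset (Finset ℕ)) := by
    intro M
    rw [← hActmap, Finset.mem_map]
    constructor
    · intro h; exact ⟨M, h, rfl⟩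
    · rintro ⟨M', h, hMM'⟩
      have : M' = M := Subtype.ext hMM'
      rw [← this]; exact h
  -- decoder for injectivity
  have hdec : ∀ N ∈ ({∅, {0}, {1}, {2}, {3}, {0, 2}, {0, 3}, {1, 3}} : Finset (Finset ℕ)), ∀ N' ∈
      ({∅, {0}, {1}, {2}, {3}, {0, 2}, {0, 3}, {1, 3}} : Finset (Finset ℕ)), τ N = τ N' → N = N' := by
    intro N hN N' hN' h
    simp only [Finset.mem_insert, Finset.mem_singleton] at hN hN'
    rcases hN with rfl | rfl | rfl | rfl | rfl | rfl | rfl | rfl <;>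
      rcases hN' with rfl | rfl | rfl | rfl | rfl | rfl | rfl | rfl <;>
      first | rfl | (exfalso; simp only [t0, t1, t2, t3, t4, t5, t6, t7] at h; norm_num at h)
  have hinj : ∀ M ∈ Act, ∀ M' ∈ Act, σ M = σ M' → M = M' := by
    intro M hM M' hM' h
    exact Subtype.ext (hdec _ ((hmemAct M).mp hM) _ ((hmemAct M').mp hM') (by rwa [hστ, hστ] at h))
  have hcardAct : Act.card = 8 := by
    rw [← Finset.card_map (Function.Embedding.subtype _), hActmap]; decide
  have hsharp : Act.card ≤ ((pathDet a d b f 5).roots.toFinset.filter fun x => 0 < x).card + 1 := by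
    rw [hcardAct]; omega
  -- the four matchings of the face (∅; 0, 2): extremes {2} (σ = −3) and {0} (σ = 1), middles {0,2} (σ = −2) and ∅ (σ = 0)
  have m2 : ({2} : Finset ℕ) ∈ S := by rw [hS]; decide
  have m02 : ({0, 2} : Finset ℕ) ∈ S := by rw [hS]; decide
  have me : (∅ : Finset ℕ) ∈ S := by rw [hS]; decide
  have m0 : ({0} : Finset ℕ) ∈ S := by rw [hS]; decide
  have A2 : (⟨{2}, m2⟩ : ↥S) ∈ Act := (hmemAct _).mpr (by simp)
  have A02 : (⟨{0, 2}, m02⟩ : ↥S) ∈ Act := (hmemAct _).mpr (by simp)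
  have Ae : (⟨∅, me⟩ : ↥S) ∈ Act := (hmemAct _).mpr (by simp)
  have A0 : (⟨{0}, m0⟩ : ↥S) ∈ Act := (hmemAct _).mpr (by simp)
  have key := faceRule_of_sharp a d b f 5 ha hb σ rfl Act rfl hinj hsharp (M₀ := ⟨{2}, m2⟩) (M₁ := ⟨{0, 2}, m02⟩)
    (M₂ := ⟨∅, me⟩) (M₃ := ⟨{0}, m0⟩) A2 A02 Ae A0
    (by rw [hστ, hστ]; show τ {2} < τ {0, 2}; rw [t3, t5]; norm_num)
    (by rw [hστ, hστ]; show τ {0, 2} ≤ τ ∅; rw [t5, t0]; norm_num)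
    (by rw [hστ, hστ]; show τ ∅ < τ {0}; rw [t0, t1]; norm_num)
    (by rw [hστ, hστ, hστ, hστ]; show τ {2} + τ {0} = τ {0, 2} + τ ∅; rw [t3, t1, t5, t0]; norm_num)
    (by rw [prod_singleton, prod_singleton, prod_pair (by norm_num), prod_empty, mul_one, mul_comm])
  -- evaluate the four gap products
  have hW : ∀ (N : Finset ℕ) (hN : N ∈ S), (⟨N, hN⟩ : ↥S) ∈ Act →
      ∏ M' ∈ Act.erase ⟨N, hN⟩, |σ ⟨N, hN⟩ - σ M'| =
        ∏ N' ∈ (({∅, {0}, {1}, {2}, {3}, {0, 2}, {0, 3}, {1, 3}} : Finset (Finset ℕ)).erase N), |τ N - τ N'| := by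
    intro N hN _
    have hmap : (({∅, {0}, {1}, {2}, {3}, {0, 2}, {0, 3}, {1, 3}} : Finset (Finset ℕ)).erase N) =
        (Act.erase ⟨N, hN⟩).map (Function.Embedding.subtype _) := by
      rw [Finset.map_erase, hActmap]; rfl
    rw [hmap, Finset.prod_map]
    rfl
  rw [hW _ m2 A2, hW _ m0 A0, hW _ m02 A02, hW _ me Ae] at key
  rw [show (({∅, {0}, {1}, {2}, {3}, {0, 2}, {0, 3}, {1, 3}} : Finset (Finset ℕ)).erase {2}) =
      {∅, {0}, {1}, {3}, {0, 2}, {0, 3}, {1, 3}} from by decide,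
    show (({∅, {0}, {1}, {2}, {3}, {0, 2}, {0, 3}, {1, 3}} : Finset (Finset ℕ)).erase {0}) =
      {∅, {1}, {2}, {3}, {0, 2}, {0, 3}, {1, 3}} from by decide,
    show (({∅, {0}, {1}, {2}, {3}, {0, 2}, {0, 3}, {1, 3}} : Finset (Finset ℕ)).erase {0, 2}) =
      {∅, {0}, {1}, {2}, {3}, {0, 3}, {1, 3}} from by decide,
    show (({∅, {0}, {1}, {2}, {3}, {0, 2}, {0, 3}, {1, 3}} : Finset (Finset ℕ)).erase ∅) =
      {{0}, {1}, {2}, {3}, {0, 2}, {0, 3}, {1, 3}} from by decide] at key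
  rw [Finset.prod_insert (by decide), Finset.prod_insert (by decide), Finset.prod_insert (by decide), Finset.prod_insert (by decide),
    Finset.prod_insert (by decide), Finset.prod_insert (by decide), Finset.prod_singleton] at key
  rw [Finset.prod_insert (by decide), Finset.prod_insert (by decide), Finset.prod_insert (by decide), Finset.prod_insert (by decide),
    Finset.prod_insert (by decide), Finset.prod_insert (by decide), Finset.prod_singleton] at key
  rw [Finset.prod_insert (by decide), Finset.prod_insert (by decide), Finset.prod_insert (by decide), Finset.prod_insert (by decide),
    Finset.prod_insert (by decide), Finset.prod_insert (by decide), Finset.prod_singleton] at key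
  rw [Finset.prod_insert (by decide), Finset.prod_insert (by decide), Finset.prod_insert (by decide), Finset.prod_insert (by decide),
    Finset.prod_insert (by decide), Finset.prod_insert (by decide), Finset.prod_singleton] at key
  rw [t0, t1, t2, t3, t4, t5, t6, t7] at key
  norm_num at key

end EdgeNormalForm

end Summit.ValiantsHypothesis.ValiantsHypothesis.Theorems.KPlusLogSqLaw
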